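import Summits.NavierStokesRegularity.NavierStokesRegularity.Theses.ClockStretchingLaw
import Summits.NavierStokesRegularity.NavierStokesRegularity.Theorems.ClockStretchingLawSteadySliceLiouville
import Summits.NavierStokesRegularity.NavierStokesRegularity.Theorems.SqueezeCycleExtremalElementExistsRescale
import Summits.NavierStokesRegularity.NavierStokesRegularity.Theorems.ClockStretchingLawClockLawStubTimeDerivBounds
import Summits.NavierStokesRegularity.NavierStokesRegularity.Theorems.ClockStretchingLawClockLawStubClockSlice
import Summits.NavierStokesRegularity.NavierStokesRegularity.Theorems.ClockStretchingLawClockLawStubZoomExtraction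
import Summits.NavierStokesRegularity.NavierStokesRegularity.Theorems.ClockStretchingLawClockLawStubLimitSingular
import Summits.NavierStokesRegularity.NavierStokesRegularity.Theorems.ClockStretchingLawClockLawStubClassPressure
import Literature.Analysis.FluidPDE.TypeIAncientMild
import HarnessLib

/-!
# Route `ClockStretchingLaw`, crux `ClockLaw` (stmt-NavierStokesRegularity-10571): THE CLOCK CANNOT STOP

If an element `u` of the route's Type-I model class `𝒦_C` (smooth, divergence-free, KNSS-mild
ancient field on `ℝ³ × (−∞,0)` with `‖u‖ ≤ C/√(−t)` and scale-invariant local energies `A, E ≤ C`)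
is SINGULAR at the space-time origin, then its CLOCK AMPLITUDE
`a_u(t) = (−t)^{3/2} ∫ ‖∂ₜu(t,x)‖² e^{−‖x‖²/(4(−t))} dx` is bounded below on `[−1, 0)`
(`clockStretchingLaw_clockLaw_proof : ClockLaw`).

Proof (line `registered` of the crux, lead revision): CONTINUITY · NO STEADY INSTANT · PERSISTENCE
UNDER THE PARABOLIC ZOOM, assembled from the landed stub files of the line —
`stub_timeDerivBounds` (universal window bounds on `∂ₜu, ∂ₜ²u`), `stub_clockSlice` (continuity of
`a_u`, a zero of the clock is a steady instant, convergence of amplitudes, zoom covariance),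
`stub_zoomExtraction` (subsequential zoom limits stay in `𝒦_C`), `classPressure_holds` (every
element of `𝒦_C` is a suitable weak solution in `Q(0,1)` with `‖u‖_{L³} + ‖p‖_{L^{3/2}} ≤ K(C)`,
from the SqueezeCycle pressure identification) and `stub_limitSingular` (persistence of the
singularity, Albritton–Barker Lemma 2.2 + Prop. 2.3) — plus the proved support item
`SteadySliceLiouville`: a zero of the clock at `t₀ < 0` would make the slice steady, hence `u ≡ 0`
(`clockStretchingLaw_steadySliceLiouville_proof`), contradicting the singularity; so `a_u > 0` on
`(−∞, 0)` for every singular element; if `inf_{[−1,0)} a_u = 0`, a minimising sequence `t_n`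
accumulates at `τ ∈ [−1, 0]`: at `τ < 0` continuity gives `a_u(τ) = 0`; at `τ = 0` the zooms
`u_n(s,y) = λ_n u(λ_n² s, λ_n y)`, `λ_n = √(−t_n)`, have `a_{u_n}(−1) = a_u(t_n) → 0` and converge
along a subsequence to a singular `W ∈ 𝒦_C` with `a_W(−1) = lim a_{u_n}(−1) = 0` — both absurd.
-/

noncomputable section

open MeasureTheory Filter Topology Set Metric Function
open scoped NNReal ENNReal

-- `Summit = Problem` namespace duplication is the tree's layout (CONVENTIONS §1); as in every Theorems file.
set_option linter.dupNamespace false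

namespace Summit.NavierStokesRegularity.NavierStokesRegularity.Theorems

open Literature.Analysis Literature.Analysis.FluidPDE
open Summit.NavierStokesRegularity.NavierStokesRegularity.Theorems.ClockLaw.Birth

/-! ### The class in the tree's vocabulary -/

/-- The route's inline KNSS-mild clause (Oseen kernel written out through `heatKernel`) is the
tree's `IsTypeIAncientMild` (definitional unfolding of `oseenKernel`/`oseenWeightA`/`oseenWeightB`). -/
theorem clockLaw_isTypeIAncientMild_of_inline {C : ℝ}
    {u : ℝ → EuclideanSpace ℝ (Fin 3) → EuclideanSpace ℝ (Fin 3)}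
    (h1 : ContDiffOn ℝ (⊤ : ℕ∞) (Function.uncurry u) (Set.Iio 0 ×ˢ Set.univ))
    (h2 : ∀ t < 0, Literature.Analysis.FluidPDE.VectorCalculus.IsDivFree (u t))
    (h3 : ∀ s t : ℝ, s < t → t < 0 → ∀ x, u t x = Literature.Analysis.FluidPDE.heatFlow (u s) (t - s) x - ∫ τ in Set.Ioo s t, ∫ y, ((-(inner ℝ (x - y) (u τ y) / (2 * (t - τ)) * Literature.Analysis.UnboundedOperators.heatKernel (t - τ) (x - y))) • u τ y + (∫ σ in Set.Ioi (t - τ), Literature.Analysis.UnboundedOperators.heatKernel σ (x - y) / (4 * σ ^ 2)) • (inner ℝ (x - y) (u τ y) • u τ y + inner ℝ (u τ y) (u τ y) • (x - y) + inner ℝ (x - y) (u τ y) • u τ y) - ((∫ σ in Set.Ioi (t - τ), Literature.Analysis.UnboundedOperators.heatKernel σ (x - y) / (8 * σ ^ 3)) * (inner ℝ (x - y) (u τ y) * inner ℝ (x - y) (u τ y))) • (x - y)))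
    (h4 : Literature.Analysis.FluidPDE.HasTypeITimeDecay C u) :
    IsTypeIAncientMild C u := by
  rw [isTypeIAncientMild_iff]
  refine ⟨h1, h2, fun s t hst ht x => ?_, h4⟩
  rw [h3 s t hst ht x]
  rfl

/-- **One steady slice kills a Type-I KNSS-mild field** — the proved support item
`SteadySliceLiouville` over `IsTypeIAncientMild`. -/
theorem clockLaw_eq_zero_of_steady_slice {C : ℝ}
    {u : ℝ → EuclideanSpace ℝ (Fin 3) → EuclideanSpace ℝ (Fin 3)} (hu : IsTypeIAncientMild C u)
    {t₀ : ℝ} (ht₀ : t₀ < 0) (hsteady : ∀ x, timeDeriv u t₀ x = 0) : ∀ t < 0, ∀ x, u t x = 0 := by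
  obtain ⟨h1, h2, h3, h4⟩ := (isTypeIAncientMild_iff (C := C) (u := u)).1 hu
  exact clockStretchingLaw_steadySliceLiouville_proof C u
    ⟨h1, h2, fun s t hst ht x => by rw [h3 s t hst ht x]; rfl, h4⟩ t₀ ht₀ hsteady

/-! ### Positivity of the clock amplitude of a singular element -/

/-- The clock amplitude is nonnegative at negative times. -/
theorem clockLaw_amp_nonneg (u : ℝ → EuclideanSpace ℝ (Fin 3) → EuclideanSpace ℝ (Fin 3)) {t : ℝ}
    (ht : t < 0) :
    0 ≤ (-t) ^ ((3 : ℝ) / 2) * ∫ x, ‖timeDeriv u t x‖ ^ 2 * Real.exp (-(‖x‖ ^ 2) / (4 * (-t))) := by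
  refine mul_nonneg (Real.rpow_nonneg (by linarith) _) (integral_nonneg fun x => ?_)
  positivity

/-- **The clock of a singular element of `𝒦_C` never reads zero**: a zero at `t < 0` is a steady
instant (`stub_clockSlice` (ii) with `stub_timeDerivBounds`), one steady instant forces `u ≡ 0`
(`SteadySliceLiouville`), and the zero field is not singular. -/
theorem clockLaw_amp_pos {C : ℝ} {u : ℝ → EuclideanSpace ℝ (Fin 3) → EuclideanSpace ℝ (Fin 3)}
    (hu : IsTypeIAncientMild C u)
    (hsing : ∀ r > 0, ∀ M : ℝ, ∃ t ∈ Set.Ioo (-(r ^ 2)) (0 : ℝ),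
      ∃ x ∈ Metric.ball (0 : EuclideanSpace ℝ (Fin 3)) r, M < ‖u t x‖)
    {t : ℝ} (ht : t < 0) :
    0 < (-t) ^ ((3 : ℝ) / 2) * ∫ x, ‖timeDeriv u t x‖ ^ 2 * Real.exp (-(‖x‖ ^ 2) / (4 * (-t))) := by
  rcases (clockLaw_amp_nonneg u ht).lt_or_eq with hlt | heq
  · exact hlt
  · exfalso
    have hsteady : ∀ x, timeDeriv u t x = 0 :=
      (stub_clockSlice stub_timeDerivBounds).2.1 C u hu t ht heq.symm
    have hzero := clockLaw_eq_zero_of_steady_slice hu ht hsteady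
    obtain ⟨s, hs, x, -, hM⟩ := hsing 1 one_pos 0
    rw [hzero s hs.2, norm_zero] at hM
    exact lt_irrefl _ hM

/-! ### Persistence under the parabolic zoom -/

/-- **The endpoint `t ↑ 0` is transferred to the instant `s = −1` of a singular zoom limit.** For a
singular element of `𝒦_C` and instants `t_n ∈ [−1, 0)` with `t_n → 0`, there are a singular
`W ∈ 𝒦_C` and a subsequence `φ` with `a_u(t_{φ n}) → a_W(−1)` (scales `λ_n = √(−t_n)`,
`stub_zoomExtraction`, `classPressure_holds` + `stub_limitSingular`, and `stub_clockSlice`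
(iii)–(iv): `a_u(t_n) = a_{u_{λ_n}}(−1)`). -/
theorem clockLaw_zoomPersistence {C : ℝ} {u : ℝ → EuclideanSpace ℝ (Fin 3) → EuclideanSpace ℝ (Fin 3)}
    (hu : IsTypeIAncientMild C u)
    (hE : ∀ (x₀ : EuclideanSpace ℝ (Fin 3)) (t₀ r : ℝ), t₀ ≤ 0 → 0 < r →
      (∀ t, t₀ - r ^ 2 < t → t < t₀ → r⁻¹ * ∫ x in Metric.ball x₀ r, ‖u t x‖ ^ 2 ≤ C) ∧
        r⁻¹ * ∫ t in Set.Ioo (t₀ - r ^ 2) t₀, ∫ x in Metric.ball x₀ r, ‖fderiv ℝ (u t) x‖ ^ 2 ≤ C)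
    (hsing : ∀ r > 0, ∀ M : ℝ, ∃ t ∈ Set.Ioo (-(r ^ 2)) (0 : ℝ),
      ∃ x ∈ Metric.ball (0 : EuclideanSpace ℝ (Fin 3)) r, M < ‖u t x‖)
    (t : ℕ → ℝ) (ht : ∀ n, -1 ≤ t n ∧ t n < 0) :
    ∃ W : ℝ → EuclideanSpace ℝ (Fin 3) → EuclideanSpace ℝ (Fin 3), IsTypeIAncientMild C W ∧
      (∀ r > 0, ∀ M : ℝ, ∃ t ∈ Set.Ioo (-(r ^ 2)) (0 : ℝ),
        ∃ x ∈ Metric.ball (0 : EuclideanSpace ℝ (Fin 3)) r, M < ‖W t x‖) ∧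
      ∃ φ : ℕ → ℕ, StrictMono φ ∧
        Tendsto (fun n => (-(t (φ n))) ^ ((3 : ℝ) / 2) *
          ∫ x, ‖timeDeriv u (t (φ n)) x‖ ^ 2 * Real.exp (-(‖x‖ ^ 2) / (4 * (-(t (φ n)))))) atTop
          (𝓝 ((-(-1 : ℝ)) ^ ((3 : ℝ) / 2) *
            ∫ x, ‖timeDeriv W (-1) x‖ ^ 2 * Real.exp (-(‖x‖ ^ 2) / (4 * (-(-1 : ℝ)))))) := by
  obtain ⟨-, -, hconv, hcov⟩ := stub_clockSlice stub_timeDerivBounds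
  -- the scales
  set c : ℕ → ℝ := fun n => Real.sqrt (-(t n)) with hc
  have hcpos : ∀ n, 0 < c n := fun n => Real.sqrt_pos.2 (neg_pos.2 (ht n).2)
  have hcsq : ∀ n, c n ^ 2 = -(t n) := fun n => Real.sq_sqrt (neg_nonneg.2 (ht n).2.le)
  -- extraction
  obtain ⟨φ, hφ, W, hW, hWE, hpt⟩ := stub_zoomExtraction C u hu hE c hcpos
  -- the limit is singular
  have hWsing := stub_limitSingular classPressure_holds C u hu hE hsing (c ∘ φ) (fun j => hcpos (φ j)) W hpt
  -- the zooms are in the class with the same constant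
  have hzoom : ∀ j, IsTypeIAncientMild C (c (φ j) • stPull (c (φ j) ^ 2) (c (φ j)) 0 0 u) :=
    fun j => isTypeIAncientMild_zoom hu (hcpos (φ j)) 0
  -- convergence of the clock amplitudes at `s = -1`
  have hlimA := hconv C _ W hzoom hW hpt (-1) (by norm_num)
  -- covariance: `a_{u_c}(-1) = a_u(-c²) = a_u(t n)`
  refine ⟨W, hW, hWsing, φ, hφ, ?_⟩
  refine hlimA.congr fun j => ?_
  rw [hcov C u hu (c (φ j)) (hcpos (φ j)) (-1) (by norm_num)]
  simp only [mul_neg_one, hcsq, neg_neg]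

/-! ### The crux -/

/-- **`ClockLaw` holds** (crux stmt-NavierStokesRegularity-10571 of route `ClockStretchingLaw`):
the clock amplitude of a singular element of the Type-I model class is bounded below on `[−1, 0)`
(compactness of `[−1, 0]`: continuity at `τ < 0`, persistence under the zoom at `τ = 0`, and
positivity of the clock of singular elements). -/
theorem clockStretchingLaw_clockLaw_proof :
    Summit.NavierStokesRegularity.NavierStokesRegularity.Theses.ClockStretchingLaw.ClockLaw := by
  intro C u hu hsing
  obtain ⟨h1, h2, h3, h4, hE⟩ := hu
  have hu' : IsTypeIAncientMild C u := clockLaw_isTypeIAncientMild_of_inline h1 h2 h3 h4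
  obtain ⟨hS1, -, -, -⟩ := stub_clockSlice stub_timeDerivBounds
  by_contra h
  push Not at h
  -- a sequence of instants in `[−1, 0)` along which the amplitude is `< 1/(n+1)`
  have hseq : ∀ n : ℕ, ∃ t : ℝ, -1 ≤ t ∧ t < 0 ∧ (-t) ^ ((3 : ℝ) / 2) *
      ∫ x, ‖timeDeriv u t x‖ ^ 2 * Real.exp (-(‖x‖ ^ 2) / (4 * (-t))) < 1 / ((n : ℝ) + 1) := by
    intro n
    obtain ⟨t, ht1, ht2, hlt⟩ := h _ Nat.one_div_pos_of_nat
    exact ⟨t, ht1, ht2, hlt⟩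
  choose t ht using hseq
  -- any subsequential limit of the amplitudes is `≤ 0`
  have hsmall : ∀ ψ : ℕ → ℕ, StrictMono ψ → ∀ L : ℝ,
      Tendsto (fun n => (-(t (ψ n))) ^ ((3 : ℝ) / 2) *
        ∫ x, ‖timeDeriv u (t (ψ n)) x‖ ^ 2 * Real.exp (-(‖x‖ ^ 2) / (4 * (-(t (ψ n)))))) atTop (𝓝 L) →
      L ≤ 0 := by
    intro ψ hψ L hL
    have hb : Tendsto (fun n : ℕ => 1 / ((ψ n : ℝ) + 1)) atTop (𝓝 0) :=
      (tendsto_one_div_add_atTop_nhds_zero_nat (𝕜 := ℝ)).comp hψ.tendsto_atTop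
    exact le_of_tendsto_of_tendsto' hL hb fun n => (ht (ψ n)).2.2.le
  -- compactness of `[−1, 0]`
  obtain ⟨τ, hτmem, φ₀, hφ₀, hlim⟩ :=
    (isCompact_Icc : IsCompact (Set.Icc (-1 : ℝ) 0)).tendsto_subseq
      (fun n => (⟨(ht n).1, (ht n).2.1.le⟩ : t n ∈ Set.Icc (-1 : ℝ) 0))
  rcases hτmem.2.eq_or_lt with hτ0 | hτneg
  · -- `τ = 0`: zoom and positivity of the limit model's clock at `s = −1`
    obtain ⟨W, hW, hWsing, φ, hφ, hconvW⟩ :=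
      clockLaw_zoomPersistence hu' hE hsing (t ∘ φ₀) (fun n => ⟨(ht (φ₀ n)).1, (ht (φ₀ n)).2.1⟩)
    have hle := hsmall (φ₀ ∘ φ) (hφ₀.comp hφ) _ hconvW
    exact absurd (clockLaw_amp_pos hW hWsing (by norm_num : (-1 : ℝ) < 0)) (not_lt.2 hle)
  · -- `τ < 0`: continuity and positivity of the clock at `τ`
    have hcont := (hS1 C u hu').continuousAt (Iio_mem_nhds hτneg)
    have hconvτ := hcont.tendsto.comp hlim
    have hle := hsmall φ₀ hφ₀ _ hconvτ
    exact absurd (clockLaw_amp_pos hu' hsing hτneg) (not_lt.2 hle)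

end Summit.NavierStokesRegularity.NavierStokesRegularity.Theorems

end
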